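/-
Copyright (c) 2026 the pub-hodgecm-mathlib formalisation cell (harness21).  Prover seat hodgecm-mathlib-K2E3-p17 (g7), Track B «K2-LIT» ∕ h413
(`stmt-HodgeConjecture-24833`), line `K2_E3_EllipticInputs`, unit U12 §L, road «GL-[M6]-sc» (owner K2E3-p23 (g5)), MEMO «M6sc-BLUEPRINT v4» §2 brick T15-log
(SPLIT HALF, Lie-algebra level), part 2 of 2: «`1_{𝔤′_split} · ‖disc χ‖^{−1∕2−ε} ∈ L¹_loc(𝔤𝔩₃(F))` FROM THE BOREL-SLICE IDENTITY».  2026-09-04.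
-/
import Summits.HodgeConjecture.HodgeConjecture.Theorems.K2E3GL3BorelSliceDensity          -- ★ (3J) p857955: §1 box lemma; brings ★ A2 `K2E3GL3UpperSliceFubini`, ★ H2a `K2E3GL3SplitOrbitalMeasureDensity`
import Summits.HodgeConjecture.HodgeConjecture.Theorems.K2E3GL3SplitDiscriminantBoxIntegral -- ★ part 1 (this seat): `lintegral_pi_three_indicator_vandermonde_rpow_neg_lt_top`, `discr_charpoly_borelSlice`
import HarnessLib

/-!
# K2_E3 road (h413), §L — brick T15-log, split half: `X ↦ 1[disc χ_X ≠ 0, χ_X has 3 roots in F] · ‖disc χ_X‖_F^{-(1/2+ε)}` is locally integrable on `𝔤𝔩₃(F)`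

Cell `pub/hodgecm-mathlib` (D-0151), Track B, seat K2E3-p17 (g7); MEMO «M6sc-BLUEPRINT v4» (K2E3-p23 (g5)) §0.3 ∕ §2 «T15-log (a)» — Harish-Chandra's Theorem 15
(local integrability of `|D(x)|^{-1/2-ε}`) for the SPLIT Cartan of `GL₃`, on the Lie algebra, read off the Borel-slice identity ★ (3J) (road owner K2E3-p23 RULINGS
#12 (M12-2) «start NOW with the split half»).  `--supports stmt-HodgeConjecture-24833 --as helper`; THEOREMS ONLY (no definition ∕ instance ∕ notation ∕ named fact ∕
`sorry`); never imports `Cruxes/…/Lines`.  COUNT-NEUTRAL.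

THE MATHEMATICS.  §1 re-exports the `ℝ≥0∞` Borel-slice identity (internal to ★ (3J)): for measurable `g ≥ 0`,
`∫_K ∫_{F⁶} g(k b(r) k⁻¹) dr dk = c · ∫_{𝔤′} g · ‖disc χ‖^{-1/2} dμ𝔤`, `𝔤′ = {disc χ ≠ 0, #roots = 3}`, `b(r) = [[r₀,r₁,r₂],[0,r₃,r₄],[0,0,r₅]]`
(★ A2 `lintegral_glInt_upperSlice_eq` ∘ ★ H2a `exists_lintegral_delta_orbital_eq`).  Read against `g = 1_S · ‖disc χ‖^{-ε}` (`S` compact): since `disc χ_{b(r)} =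
Δ(r₀,r₃,r₅)²`, `Δ(d) = (d₀−d₁)(d₀−d₂)(d₁−d₂)` (★ part 1), and `k b(r) k⁻¹ ∈ S` forces `r` into a box `(𝔭^{-m})⁶` (★ (3J) §1), the right-hand side
`c ∫_{S ∩ 𝔤′} ‖disc χ‖^{-1/2-ε}` is at most `κ(K) · dx(𝔭^{-m})³ · ∫_{(𝔭^{-m})³} ‖Δ(d)‖^{-2ε} dd` (the split `F⁶ = F³ × F³` is ★ A2 `measurePreserving_mergeChart`).
and ★ part 1 gives `∫_{(𝔭^{-m})³} ‖Δ(d)‖^{-2ε} dd < ∞` for `2ε < 1/2`.  §2: for every real `ε < 1/4`, **`X ↦ 1_{𝔤′}(X) ‖disc χ_X‖^{-(1/2+ε)}` is locally integrable** (`ℝ≥0∞`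
form on compacta + the `LocallyIntegrable` real form) — the split-class part of the weight `|D♮|^{-1/2}(1+|log|D♮||)^κ` of the road's ASM is dominated by it on
compacta (`(1+|log t|)^κ ≤ C_{κ,ε,T} t^{-ε}` on `(0,T]`, `ε > 0`).
[HarishChandra1970, Part V §6 Thm. 15 p. 63, Part VII §3] [HarishChandra1999AdmissibleDistributions, Thm. 7.7, Lemma 7.9, §15] [WeilBNT1967, Ch. I §2–§4]
HONEST LABEL: HC_CM is proved only modulo the 7 printed citations (2 remaining named inputs: hLiu418 = stmt-HodgeConjecture-24832, h413 = stmt-HodgeConjecture-24833)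
until rung 0 closes; count-neutral helper (the mixed half comes from ★ (LBGL-3E) p858128 in a sibling file).

## Mathlib ∕ tree search
Tree: ★ A2 `K2E3GL3UpperSliceFubini.{measurePreserving_mergeChart, lintegral_glInt_upperSlice_eq}`, ★ H2a `K2E3GL3SplitOrbitalMeasureDensity.exists_lintegral_delta_orbital_eq`,
★ (3J) `K2E3GL3BorelSliceDensity.exists_forall_mem_primePowBall_of_isCompact`, ★ part 1 `K2E3GL3SplitDiscriminantBoxIntegral.{lintegral_pi_three_indicator_vandermonde_rpow_neg_lt_top,
discr_charpoly_borelSlice}`, ★ `isOpen_setOf_charpoly_discr_ne_zero_and_card_roots_eq`, ★ `continuous_discr_charpoly`, ★ `measurable_normAbs`, ★ `measure_primePowBall_lt_top`.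
Mathlib: `lintegral_prod_mul`, `MeasurePreserving.lintegral_comp`, `ENNReal.rpow_add`, `ENNReal.mul_rpow_of_ne_top`, `ENNReal.coe_rpow_of_nonneg`, `ENNReal.ofReal_rpow_of_pos`, `locallyIntegrable_iff`.
Dedup: `rg "discr.*rpow.*LocallyIntegrable|borelSlice_eq|lintegral_glInt_borelSlice|split_rpow_neg"` over Literature∕Summits — no hits.

## References
* [HarishChandra1970] Harish-Chandra (van Dijk), *Harmonic Analysis on Reductive p-adic Groups*, LNM 162 (1970), Part V §6 Thm. 15, Part VII §3.
* [HarishChandra1999AdmissibleDistributions] Harish-Chandra (DeBacker–Sally), *Admissible Invariant Distributions on Reductive p-adic Groups* (1999), Thm. 7.7, Lemma 7.9, §15.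
* [WeilBNT1967] A. Weil, *Basic Number Theory* (1967), Ch. I §2–§4.
-/

set_option autoImplicit false
set_option linter.dupNamespace false

noncomputable section

open MeasureTheory MeasureTheory.Measure Set Matrix Topology Polynomial Filter
open scoped MatrixGroups NNReal ENNReal
open Literature.NumberTheory.GaloisRepresentations Literature.NumberTheory.GaloisRepresentations.IsNonarchimedeanLocalField
open Literature.NumberTheory.Automorphic Literature.NumberTheory.Automorphic.LocalFieldHaar
open Summit.HodgeConjecture.HodgeConjecture.Cruxes.H413.K2E3GL3SplitTorusWeylKit
open Summit.HodgeConjecture.HodgeConjecture.Cruxes.H413.K2E3CubicRationalRootsLocallyConstant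
open Summit.HodgeConjecture.HodgeConjecture.Cruxes.H413.K2E3GL3SplitDiscriminantBoxIntegral

namespace Summit.HodgeConjecture.HodgeConjecture.Cruxes.H413.K2E3GL3SplitDiscriminantLocIntegrable


/-! ## §1  The `ℝ≥0∞` Borel-slice identity (re-exported from the ingredients of ★ (3J)) and the box of a compact set -/

section SliceIdentity

variable {F : Type*} [Field F] [ValuativeRel F] [TopologicalSpace F] [IsNonarchimedeanLocalField F]
variable [MeasurableSpace F] [BorelSpace F] [MeasurableSpace (GL (Fin 3) F)] [BorelSpace (GL (Fin 3) F)]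
  [MeasurableSpace (Matrix (Fin 3) (Fin 3) F)] [BorelSpace (Matrix (Fin 3) (Fin 3) F)]

/-- **THE `ℝ≥0∞` BOREL-SLICE IDENTITY OF `𝔤𝔩₃(F)`**: there is `c ∈ (0, ∞)` with `∫_K ∫_{F⁶} g(k b(r) k⁻¹) dr dk = c · ∫_{𝔤′} g(Y) ‖disc χ_Y‖^{-1∕2} dμ𝔤(Y)` for EVERY
measurable `g ≥ 0`, `𝔤′ = {disc χ ≠ 0, #roots = 3}` (★ A2 `∫_K∫_𝔟 = C∫_{F³}‖Δ‖∫_{K×N₃}` then ★ H2a: the split orbital measure has density `c′(√‖disc‖)⁻¹ 1_{𝔤′}`).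
This is the identity behind the `C_c^∞` head of ★ (3J) `exists_borelSliceDensity`, exported for non-negative measurable integrands.
[cite: HarishChandra1999AdmissibleDistributions, Thm. 7.7, Lemma 7.8] [cite: HarishChandra1970, Part V §4 Lemma 22] -/
theorem exists_lintegral_glInt_borelSlice_eq (κ : Measure ↥(glInt 3 F)) [IsHaarMeasure κ]
    (μ𝔤 : Measure (Matrix (Fin 3) (Fin 3) F)) [μ𝔤.IsAddHaarMeasure] (dx : Measure F) [dx.IsAddHaarMeasure] :
    ∃ c : ℝ≥0∞, c ≠ 0 ∧ c ≠ ⊤ ∧ ∀ g : Matrix (Fin 3) (Fin 3) F → ℝ≥0∞, Measurable g →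
      ∫⁻ k : ↥(glInt 3 F), ∫⁻ r : Fin 6 → F,
          g (((k : GL (Fin 3) F) : Matrix (Fin 3) (Fin 3) F) * !![r 0, r 1, r 2; 0, r 3, r 4; 0, 0, r 5] *
            ((((k : GL (Fin 3) F))⁻¹ : GL (Fin 3) F) : Matrix (Fin 3) (Fin 3) F)) ∂(Measure.pi fun _ : Fin 6 => dx) ∂κ =
        c * ∫⁻ Y in {Y : Matrix (Fin 3) (Fin 3) F | Y.charpoly.discr ≠ 0 ∧ Y.charpoly.roots.card = 3},
          g Y * (((NNReal.sqrt (normAbs F Y.charpoly.discr))⁻¹ : ℝ≥0) : ℝ≥0∞) ∂μ𝔤 := by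
  haveI : T2Space F := (isLocalField F).toT2Space
  haveI : LocallyCompactSpace F := (isLocalField F).toLocallyCompactSpace
  haveI : SecondCountableTopology F := secondCountableTopology_localField F
  haveI : IsTopologicalRing F := inferInstance
  haveI : T2Space (GL (Fin 3) F) := t2Space_generalLinearGroup F 3
  haveI : SecondCountableTopology (Matrix (Fin 3) (Fin 3) F) := inferInstanceAs (SecondCountableTopology (Fin 3 → Fin 3 → F))
  haveI : SecondCountableTopology (Matrix (Fin 3) (Fin 3) F)ᵐᵒᵖ := MulOpposite.opHomeomorph.symm.secondCountableTopology
  haveI : SecondCountableTopology (GL (Fin 3) F) := Units.isEmbedding_embedProduct.secondCountableTopology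
  haveI : LocallyCompactSpace (GL (Fin 3) F) := locallyCompactSpace_generalLinearGroup F 3
  haveI : LocallyCompactSpace ↥(unipotentRadicalGL F (id : Fin 3 → Fin 3)) :=
    (isClosed_unipotentRadicalGL (R := F) (id : Fin 3 → Fin 3)).locallyCompactSpace
  haveI : BorelSpace ↥(unipotentRadicalGL F (id : Fin 3 → Fin 3)) := Subtype.borelSpace _
  set μN : Measure ↥(unipotentRadicalGL F (id : Fin 3 → Fin 3)) := Measure.haar with hμN
  obtain ⟨C, hC0, hCt, hA2⟩ := K2E3GL3UpperSliceFubini.lintegral_glInt_upperSlice_eq (F := F) κ μN dx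
  obtain ⟨c', hc'0, hc't, hH⟩ := K2E3GL3SplitOrbitalMeasureDensity.exists_lintegral_delta_orbital_eq κ μN μ𝔤 dx
  refine ⟨C * c', mul_ne_zero hC0 hc'0, ENNReal.mul_ne_top hCt hc't, fun g hg => ?_⟩
  rw [hA2 g hg, hH g hg, mul_assoc]

omit [MeasurableSpace F] [BorelSpace F] [MeasurableSpace (GL (Fin 3) F)] [BorelSpace (GL (Fin 3) F)]
  [MeasurableSpace (Matrix (Fin 3) (Fin 3) F)] [BorelSpace (Matrix (Fin 3) (Fin 3) F)] in
/-- **The slice coordinates hitting a compact set are bounded, uniformly over `K`**: for compact `S ⊆ 𝔤𝔩₃(F)` there is `m` with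
`k b(r) k⁻¹ ∈ S ⇒ r ∈ (𝔭^{-m})⁶` (`Ad(K)⁻¹S` is compact; ★ (3J) §1). [cite: WeilBNT1967, Ch. II n° 27] -/
theorem exists_forall_conj_borelSlice_mem_imp {S : Set (Matrix (Fin 3) (Fin 3) F)} (hS : IsCompact S) :
    ∃ m : ℕ, ∀ (k : ↥(glInt 3 F)) (r : Fin 6 → F),
      ((k : GL (Fin 3) F) : Matrix (Fin 3) (Fin 3) F) * !![r 0, r 1, r 2; 0, r 3, r 4; 0, 0, r 5] *
          ((((k : GL (Fin 3) F))⁻¹ : GL (Fin 3) F) : Matrix (Fin 3) (Fin 3) F) ∈ S →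
        ∀ i, r i ∈ primePowBall F (-(m : ℤ)) := by
  haveI : T2Space F := (isLocalField F).toT2Space
  haveI : IsTopologicalRing F := inferInstance
  have hSK : IsCompact ((fun p : ↥(glInt 3 F) × Matrix (Fin 3) (Fin 3) F =>
      ((((p.1 : GL (Fin 3) F))⁻¹ : GL (Fin 3) F) : Matrix (Fin 3) (Fin 3) F) * p.2 * ((p.1 : GL (Fin 3) F) : Matrix (Fin 3) (Fin 3) F)) '' (univ ×ˢ S)) := by
    haveI : CompactSpace ↥(glInt 3 F) := isCompact_iff_compactSpace.1 (isCompact_glInt (n := 3) (F := F))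
    exact (isCompact_univ.prod hS).image ((((Units.continuous_coe_inv.comp (continuous_subtype_val.comp continuous_fst))).mul continuous_snd).mul
      (Units.continuous_val.comp (continuous_subtype_val.comp continuous_fst)))
  obtain ⟨m, hm⟩ := K2E3GL3BorelSliceDensity.exists_forall_mem_primePowBall_of_isCompact hSK
  refine ⟨m, fun k r hkr i => ?_⟩
  have hb : (!![r 0, r 1, r 2; 0, r 3, r 4; 0, 0, r 5] : Matrix (Fin 3) (Fin 3) F) ∈ (fun p : ↥(glInt 3 F) × Matrix (Fin 3) (Fin 3) F =>
      ((((p.1 : GL (Fin 3) F))⁻¹ : GL (Fin 3) F) : Matrix (Fin 3) (Fin 3) F) * p.2 * ((p.1 : GL (Fin 3) F) : Matrix (Fin 3) (Fin 3) F)) '' (univ ×ˢ S) := by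
    refine ⟨(k, ((k : GL (Fin 3) F) : Matrix (Fin 3) (Fin 3) F) * !![r 0, r 1, r 2; 0, r 3, r 4; 0, 0, r 5] *
      ((((k : GL (Fin 3) F))⁻¹ : GL (Fin 3) F) : Matrix (Fin 3) (Fin 3) F)), ⟨Set.mem_univ _, hkr⟩, ?_⟩
    simp only
    rw [show ((((k : GL (Fin 3) F))⁻¹ : GL (Fin 3) F) : Matrix (Fin 3) (Fin 3) F) * (((k : GL (Fin 3) F) : Matrix (Fin 3) (Fin 3) F) *
        !![r 0, r 1, r 2; 0, r 3, r 4; 0, 0, r 5] * ((((k : GL (Fin 3) F))⁻¹ : GL (Fin 3) F) : Matrix (Fin 3) (Fin 3) F)) * ((k : GL (Fin 3) F) : Matrix (Fin 3) (Fin 3) F)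
        = (((((k : GL (Fin 3) F))⁻¹ : GL (Fin 3) F) : Matrix (Fin 3) (Fin 3) F) * ((k : GL (Fin 3) F) : Matrix (Fin 3) (Fin 3) F)) * !![r 0, r 1, r 2; 0, r 3, r 4; 0, 0, r 5] *
        (((((k : GL (Fin 3) F))⁻¹ : GL (Fin 3) F) : Matrix (Fin 3) (Fin 3) F) * ((k : GL (Fin 3) F) : Matrix (Fin 3) (Fin 3) F)) by simp only [Matrix.mul_assoc],
      Units.inv_mul, Matrix.one_mul, Matrix.mul_one]
  have he := hm _ hb
  fin_cases i
  · exact he 0 0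
  · exact he 0 1
  · exact he 0 2
  · exact he 1 1
  · exact he 1 2
  · exact he 2 2

end SliceIdentity

/-! ## §2  `1_{𝔤′} ‖disc χ‖^{-(1/2+ε)} ∈ L¹_loc(𝔤𝔩₃(F))` for `0 ≤ ε < 1/4` -/

section Main

variable {F : Type*} [Field F] [ValuativeRel F] [TopologicalSpace F] [IsNonarchimedeanLocalField F]
variable [MeasurableSpace (Matrix (Fin 3) (Fin 3) F)] [BorelSpace (Matrix (Fin 3) (Fin 3) F)]

/-- **THE SPLIT-CLASS SINGULAR INTEGRAL IS LOCALLY FINITE**: for compact `S ⊆ 𝔤𝔩₃(F)` and `ε < 1/4`,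
`∫_S 1_{𝔤′}(X) ‖disc χ_X‖_F^{-(1/2+ε)} dμ𝔤(X) < ∞` (`ℝ≥0∞` form; the Borel-slice identity against `g = 1_S ‖disc χ‖^{-ε}`, the box of §3 and the
three-variable estimate of ★ part 1 at `a = 2ε`). [cite: HarishChandra1970, Part V §6 Thm. 15] [cite: HarishChandra1999AdmissibleDistributions, §15, Lemma 7.9] -/
theorem setLIntegral_indicator_split_rpow_neg_lt_top (μ𝔤 : Measure (Matrix (Fin 3) (Fin 3) F)) [μ𝔤.IsAddHaarMeasure]
    {S : Set (Matrix (Fin 3) (Fin 3) F)} (hS : IsCompact S) {ε : ℝ} (hε : ε < 1 / 4) :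
    ∫⁻ X in S, {Y : Matrix (Fin 3) (Fin 3) F | Y.charpoly.discr ≠ 0 ∧ Y.charpoly.roots.card = 3}.indicator
        (fun Y => ((normAbs F Y.charpoly.discr : ℝ≥0∞)) ^ (-(1 / 2 + ε))) X ∂μ𝔤 < ∞ := by
  classical
  haveI : T2Space F := (isLocalField F).toT2Space
  haveI : LocallyCompactSpace F := (isLocalField F).toLocallyCompactSpace
  haveI : SecondCountableTopology F := secondCountableTopology_localField F
  haveI : IsTopologicalRing F := inferInstance
  letI : MeasurableSpace F := borel F
  haveI : BorelSpace F := ⟨rfl⟩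
  letI : MeasurableSpace (GL (Fin 3) F) := borel (GL (Fin 3) F)
  haveI : BorelSpace (GL (Fin 3) F) := ⟨rfl⟩
  haveI : T2Space (GL (Fin 3) F) := t2Space_generalLinearGroup F 3
  haveI : T2Space (Matrix (Fin 3) (Fin 3) F) := inferInstanceAs (T2Space (Fin 3 → Fin 3 → F))
  haveI : SecondCountableTopology (Matrix (Fin 3) (Fin 3) F) := inferInstanceAs (SecondCountableTopology (Fin 3 → Fin 3 → F))
  haveI : SecondCountableTopology (Matrix (Fin 3) (Fin 3) F)ᵐᵒᵖ := MulOpposite.opHomeomorph.symm.secondCountableTopology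
  haveI : SecondCountableTopology (GL (Fin 3) F) := Units.isEmbedding_embedProduct.secondCountableTopology
  haveI : SecondCountableTopology ↥(glInt 3 F) := TopologicalSpace.Subtype.secondCountableTopology _
  haveI : BorelSpace ↥(glInt 3 F) := Subtype.borelSpace _
  haveI : CompactSpace ↥(glInt 3 F) := isCompact_iff_compactSpace.1 (isCompact_glInt (n := 3) (F := F))
  haveI : LocallyCompactSpace (GL (Fin 3) F) := locallyCompactSpace_generalLinearGroup F 3
  haveI : LocallyCompactSpace ↥(glInt 3 F) := (isOpen_glInt 3 F).isOpenEmbedding_subtypeVal.locallyCompactSpace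
  set κ : Measure ↥(glInt 3 F) := Measure.haar with hκ
  haveI : IsFiniteMeasure κ := CompactSpace.isFiniteMeasure
  set dx : Measure F := Measure.addHaar with hdx
  haveI : SFinite dx := inferInstance
  obtain ⟨c, hc0, hct, hid⟩ := exists_lintegral_glInt_borelSlice_eq κ μ𝔤 dx
  -- abbreviations
  set 𝔤' : Set (Matrix (Fin 3) (Fin 3) F) := {Y : Matrix (Fin 3) (Fin 3) F | Y.charpoly.discr ≠ 0 ∧ Y.charpoly.roots.card = 3} with h𝔤'
  have h𝔤'm : MeasurableSet 𝔤' := (isOpen_setOf_charpoly_discr_ne_zero_and_card_roots_eq 3).measurableSet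
  have hdiscm : Measurable fun Y : Matrix (Fin 3) (Fin 3) F => Y.charpoly.discr := (F0P3cStCharTSHCDGroupToLie.continuous_discr_charpoly (K := F)).measurable
  have hnd : Measurable fun Y : Matrix (Fin 3) (Fin 3) F => ((normAbs F Y.charpoly.discr : ℝ≥0∞)) := (measurable_normAbs.comp hdiscm).coe_nnreal_ennreal
  have hSm : MeasurableSet S := hS.isClosed.measurableSet
  -- the test function `g = 1_S ‖disc χ‖^{-ε}`
  set g : Matrix (Fin 3) (Fin 3) F → ℝ≥0∞ := fun Y => S.indicator (fun Y => ((normAbs F Y.charpoly.discr : ℝ≥0∞)) ^ (-ε)) Y with hg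
  have hgapp : ∀ Y, g Y = S.indicator (fun Y => ((normAbs F Y.charpoly.discr : ℝ≥0∞)) ^ (-ε)) Y := fun _ => rfl
  have hgm : Measurable g := (hnd.pow_const _).indicator hSm
  -- (i) the right-hand side of the identity is the integral in question
  have hRHS : ∫⁻ X in S, 𝔤'.indicator (fun Y => ((normAbs F Y.charpoly.discr : ℝ≥0∞)) ^ (-(1 / 2 + ε))) X ∂μ𝔤 =
      ∫⁻ Y in 𝔤', g Y * (((NNReal.sqrt (normAbs F Y.charpoly.discr))⁻¹ : ℝ≥0) : ℝ≥0∞) ∂μ𝔤 := by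
    rw [← lintegral_indicator hSm, ← lintegral_indicator h𝔤'm]
    refine lintegral_congr fun X => ?_
    by_cases hXS : X ∈ S
    · by_cases hX : X ∈ 𝔤'
      · rw [indicator_of_mem hXS, indicator_of_mem hX, indicator_of_mem hX, hgapp, indicator_of_mem hXS]
        have ht : normAbs F X.charpoly.discr ≠ 0 := (map_ne_zero (normAbs F)).2 hX.1
        have hsq : NNReal.sqrt (normAbs F X.charpoly.discr) ≠ 0 := by rwa [ne_eq, NNReal.sqrt_eq_zero]
        rw [ENNReal.coe_inv hsq, NNReal.sqrt_eq_rpow, ENNReal.coe_rpow_of_nonneg _ (by norm_num : (0 : ℝ) ≤ 1 / 2), ← ENNReal.rpow_neg,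
          ← ENNReal.rpow_add _ _ (ENNReal.coe_ne_zero.2 ht) ENNReal.coe_ne_top]
        congr 1
        ring
      · rw [indicator_of_mem hXS, indicator_of_notMem hX, indicator_of_notMem hX]
    · rw [indicator_of_notMem hXS]
      by_cases hX : X ∈ 𝔤'
      · rw [indicator_of_mem hX, hgapp, indicator_of_notMem hXS, zero_mul]
      · rw [indicator_of_notMem hX]
  rw [hRHS]
  -- (ii) the left-hand side is bounded through the box
  obtain ⟨m, hm⟩ := exists_forall_conj_borelSlice_mem_imp (F := F) hS
  set B : Set F := primePowBall F (-(m : ℤ)) with hB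
  have hBm : MeasurableSet B := measurableSet_primePowBall _
  set R : Set (Fin 6 → F) := Set.pi univ fun _ => B with hR
  have hRm : MeasurableSet R := MeasurableSet.univ_pi fun _ => hBm
  set Q : (Fin 6 → F) → ℝ≥0∞ := fun r => ((normAbs F ((r 0 - r 3) * (r 0 - r 5) * (r 3 - r 5)) : ℝ≥0∞)) ^ (-(2 * ε)) with hQ
  have hQm : Measurable Q := by
    refine (measurable_normAbs.comp ?_).coe_nnreal_ennreal.pow_const _
    fun_prop
  have hpt : ∀ (k : ↥(glInt 3 F)) (r : Fin 6 → F),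
      g (((k : GL (Fin 3) F) : Matrix (Fin 3) (Fin 3) F) * !![r 0, r 1, r 2; 0, r 3, r 4; 0, 0, r 5] *
        ((((k : GL (Fin 3) F))⁻¹ : GL (Fin 3) F) : Matrix (Fin 3) (Fin 3) F)) ≤ R.indicator Q r := by
    intro k r
    by_cases hkr : ((k : GL (Fin 3) F) : Matrix (Fin 3) (Fin 3) F) * !![r 0, r 1, r 2; 0, r 3, r 4; 0, 0, r 5] *
        ((((k : GL (Fin 3) F))⁻¹ : GL (Fin 3) F) : Matrix (Fin 3) (Fin 3) F) ∈ S
    · have hrR : r ∈ R := Set.mem_univ_pi.2 fun i => hm k r hkr i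
      rw [hgapp, indicator_of_mem hkr, indicator_of_mem hrR, Matrix.coe_units_inv, Matrix.charpoly_units_conj, discr_charpoly_borelSlice, map_pow,
        ENNReal.coe_pow, hQ]
      simp only
      rw [← ENNReal.rpow_two, ← ENNReal.rpow_mul]
      ring_nf
      exact le_rfl
    · rw [hgapp, indicator_of_notMem hkr]
      exact zero_le
  have hLHS : ∫⁻ k : ↥(glInt 3 F), ∫⁻ r : Fin 6 → F,
      g (((k : GL (Fin 3) F) : Matrix (Fin 3) (Fin 3) F) * !![r 0, r 1, r 2; 0, r 3, r 4; 0, 0, r 5] *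
        ((((k : GL (Fin 3) F))⁻¹ : GL (Fin 3) F) : Matrix (Fin 3) (Fin 3) F)) ∂(Measure.pi fun _ : Fin 6 => dx) ∂κ ≤
      (∫⁻ r : Fin 6 → F, R.indicator Q r ∂(Measure.pi fun _ : Fin 6 => dx)) * κ univ := by
    calc ∫⁻ k : ↥(glInt 3 F), ∫⁻ r : Fin 6 → F,
          g (((k : GL (Fin 3) F) : Matrix (Fin 3) (Fin 3) F) * !![r 0, r 1, r 2; 0, r 3, r 4; 0, 0, r 5] *
            ((((k : GL (Fin 3) F))⁻¹ : GL (Fin 3) F) : Matrix (Fin 3) (Fin 3) F)) ∂(Measure.pi fun _ : Fin 6 => dx) ∂κ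
        ≤ ∫⁻ _k : ↥(glInt 3 F), ∫⁻ r : Fin 6 → F, R.indicator Q r ∂(Measure.pi fun _ : Fin 6 => dx) ∂κ :=
          lintegral_mono fun k => lintegral_mono fun r => hpt k r
      _ = (∫⁻ r : Fin 6 → F, R.indicator Q r ∂(Measure.pi fun _ : Fin 6 => dx)) * κ univ := lintegral_const _
  -- (iii) the box integral splits as `(∫_{B³} ‖Δ‖^{-2ε}) · dx(B)³`
  set f : (Fin 3 → F) → ℝ≥0∞ := fun d => (B.indicator (1 : F → ℝ≥0∞) (d 0) * B.indicator (1 : F → ℝ≥0∞) (d 1) * B.indicator (1 : F → ℝ≥0∞) (d 2)) *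
    (((normAbs F (d 0 - d 1) : ℝ≥0∞)) ^ (-(2 * ε)) * ((normAbs F (d 0 - d 2) : ℝ≥0∞)) ^ (-(2 * ε)) * ((normAbs F (d 1 - d 2) : ℝ≥0∞)) ^ (-(2 * ε)))
    with hf
  set ι : (Fin 3 → F) → ℝ≥0∞ := fun r' => B.indicator (1 : F → ℝ≥0∞) (r' 0) * B.indicator (1 : F → ℝ≥0∞) (r' 1) * B.indicator (1 : F → ℝ≥0∞) (r' 2) with hι
  have hind : Measurable (B.indicator (1 : F → ℝ≥0∞)) := measurable_one.indicator hBm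
  have hpow : ∀ (i j : Fin 3), Measurable fun d : Fin 3 → F => ((normAbs F (d i - d j) : ℝ≥0∞)) ^ (-(2 * ε)) := fun i j =>
    ((measurable_normAbs.comp ((measurable_pi_apply i).sub (measurable_pi_apply j))).coe_nnreal_ennreal.pow_const _)
  have hιm : Measurable ι := ((hind.comp (measurable_pi_apply 0)).mul (hind.comp (measurable_pi_apply 1))).mul (hind.comp (measurable_pi_apply 2))
  have hfm : Measurable f := hιm.mul (((hpow 0 1).mul (hpow 0 2)).mul (hpow 1 2))
  have hcomp : (fun p : (Fin 3 → F) × (Fin 3 → F) => R.indicator Q ((![p.1 0, p.2 0, p.2 1, p.1 1, p.2 2, p.1 2] : Fin 6 → F))) =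
      fun p => f p.1 * ι p.2 := by
    funext p
    obtain ⟨d, r'⟩ := p
    have hmem : ((![d 0, r' 0, r' 1, d 1, r' 2, d 2] : Fin 6 → F)) ∈ R ↔ (d 0 ∈ B ∧ d 1 ∈ B ∧ d 2 ∈ B) ∧ (r' 0 ∈ B ∧ r' 1 ∈ B ∧ r' 2 ∈ B) := by
      rw [hR, Set.mem_univ_pi]
      constructor
      · intro h
        exact ⟨⟨by simpa using h 0, by simpa using h 3, by simpa using h 5⟩, ⟨by simpa using h 1, by simpa using h 2, by simpa using h 4⟩⟩
      · rintro ⟨⟨h0, h1, h2⟩, ⟨h3, h4, h5⟩⟩ i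
        fin_cases i
        · simpa using h0
        · simpa using h3
        · simpa using h4
        · simpa using h1
        · simpa using h5
        · simpa using h2
    have hQval : Q ((![d 0, r' 0, r' 1, d 1, r' 2, d 2] : Fin 6 → F)) =
        ((normAbs F (d 0 - d 1) : ℝ≥0∞)) ^ (-(2 * ε)) * ((normAbs F (d 0 - d 2) : ℝ≥0∞)) ^ (-(2 * ε)) * ((normAbs F (d 1 - d 2) : ℝ≥0∞)) ^ (-(2 * ε)) := by
      simp only [hQ, Matrix.cons_val_zero, Matrix.cons_val]
      rw [map_mul, map_mul, ENNReal.coe_mul, ENNReal.coe_mul, ENNReal.mul_rpow_of_ne_top (ENNReal.mul_ne_top ENNReal.coe_ne_top ENNReal.coe_ne_top)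
        ENNReal.coe_ne_top, ENNReal.mul_rpow_of_ne_top ENNReal.coe_ne_top ENNReal.coe_ne_top]
    simp only
    by_cases hmR : ((![d 0, r' 0, r' 1, d 1, r' 2, d 2] : Fin 6 → F)) ∈ R
    · obtain ⟨⟨h0, h1, h2⟩, ⟨h3, h4, h5⟩⟩ := hmem.1 hmR
      rw [indicator_of_mem hmR, hQval, hf, hι]
      simp only [indicator_of_mem h0, indicator_of_mem h1, indicator_of_mem h2, indicator_of_mem h3, indicator_of_mem h4, indicator_of_mem h5,
        Pi.one_apply, mul_one, one_mul]
    · rw [indicator_of_notMem hmR]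
      have hnot : ¬ ((d 0 ∈ B ∧ d 1 ∈ B ∧ d 2 ∈ B) ∧ (r' 0 ∈ B ∧ r' 1 ∈ B ∧ r' 2 ∈ B)) := fun h => hmR (hmem.2 h)
      rw [hf, hι]
      simp only [not_and_or] at hnot
      rcases hnot with (h | h | h) | (h | h | h) <;> simp [indicator_of_notMem h]
  have hbox : ∫⁻ r : Fin 6 → F, R.indicator Q r ∂(Measure.pi fun _ : Fin 6 => dx) =
      (∫⁻ d, f d ∂(Measure.pi fun _ : Fin 3 => dx)) * ∫⁻ r', ι r' ∂(Measure.pi fun _ : Fin 3 => dx) := by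
    rw [← (K2E3GL3UpperSliceFubini.measurePreserving_mergeChart (F := F) dx).lintegral_comp (hQm.indicator hRm)]
    rw [show (fun p : (Fin 3 → F) × (Fin 3 → F) => R.indicator Q ((![p.1 0, p.2 0, p.2 1, p.1 1, p.2 2, p.1 2] : Fin 6 → F))) =
        fun p => f p.1 * ι p.2 from hcomp]
    exact lintegral_prod_mul hfm.aemeasurable hιm.aemeasurable
  have hι_lt : ∫⁻ r', ι r' ∂(Measure.pi fun _ : Fin 3 => dx) < ∞ := by
    have hle : ∀ r', ι r' ≤ (Set.pi univ fun _ : Fin 3 => B).indicator 1 r' := by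
      intro r'
      by_cases h : r' ∈ Set.pi univ fun _ : Fin 3 => B
      · rw [indicator_of_mem h, hι]
        simp only [Pi.one_apply]
        obtain ⟨h0, h1, h2⟩ : r' 0 ∈ B ∧ r' 1 ∈ B ∧ r' 2 ∈ B := ⟨Set.mem_univ_pi.1 h 0, Set.mem_univ_pi.1 h 1, Set.mem_univ_pi.1 h 2⟩
        simp [indicator_of_mem h0, indicator_of_mem h1, indicator_of_mem h2]
      · have hnot : ¬ (r' 0 ∈ B ∧ r' 1 ∈ B ∧ r' 2 ∈ B) := by
          intro h'
          exact h (Set.mem_univ_pi.2 fun i => by fin_cases i <;> [exact h'.1; exact h'.2.1; exact h'.2.2])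
        rw [hι]
        simp only [not_and_or] at hnot
        rcases hnot with h | h | h <;> simp [indicator_of_notMem h]
    calc ∫⁻ r', ι r' ∂(Measure.pi fun _ : Fin 3 => dx) ≤ ∫⁻ r', (Set.pi univ fun _ : Fin 3 => B).indicator 1 r' ∂(Measure.pi fun _ : Fin 3 => dx) :=
          lintegral_mono hle
      _ = (Measure.pi fun _ : Fin 3 => dx) (Set.pi univ fun _ : Fin 3 => B) := lintegral_indicator_one (MeasurableSet.univ_pi fun _ => hBm)
      _ < ∞ := by
          rw [Measure.pi_pi]
          exact ENNReal.prod_lt_top fun i _ => measure_primePowBall_lt_top dx _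
  have hf_lt : ∫⁻ d, f d ∂(Measure.pi fun _ : Fin 3 => dx) < ∞ :=
    lintegral_pi_three_indicator_vandermonde_rpow_neg_lt_top dx (-(m : ℤ)) (a := 2 * ε) (by linarith)
  -- (iv) assemble
  have hfin : c * ∫⁻ Y in 𝔤', g Y * (((NNReal.sqrt (normAbs F Y.charpoly.discr))⁻¹ : ℝ≥0) : ℝ≥0∞) ∂μ𝔤 < ∞ := by
    rw [← hid g hgm]
    refine hLHS.trans_lt ?_
    rw [hbox]
    exact ENNReal.mul_lt_top (ENNReal.mul_lt_top hf_lt hι_lt) (measure_lt_top κ _)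
  exact ENNReal.lt_top_of_mul_ne_top_right hfin.ne hc0

/-- **T15-log, SPLIT HALF (power form): `X ↦ 1[disc χ_X ≠ 0 ∧ χ_X has 3 roots in F] · ‖disc χ_X‖_F^{-(1/2+ε)}` IS LOCALLY INTEGRABLE ON `𝔤𝔩₃(F)`**
for every real `ε < 1/4` and every additive Haar measure `μ𝔤` (Harish-Chandra's Theorem 15 for the split Cartan, on the Lie algebra; at `ε = 0` this is the local
integrability of the Borel-slice density ★ (3J)). [cite: HarishChandra1970, Part V §6 Thm. 15 p. 63, Part VII §3] [cite: HarishChandra1999AdmissibleDistributions, §15] -/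
theorem locallyIntegrable_indicator_split_rpow_neg (μ𝔤 : Measure (Matrix (Fin 3) (Fin 3) F)) [μ𝔤.IsAddHaarMeasure]
    {ε : ℝ} (hε : ε < 1 / 4) :
    LocallyIntegrable (fun X : Matrix (Fin 3) (Fin 3) F =>
      {Y : Matrix (Fin 3) (Fin 3) F | Y.charpoly.discr ≠ 0 ∧ Y.charpoly.roots.card = 3}.indicator
        (fun Y => ((normAbs F Y.charpoly.discr : ℝ)) ^ (-(1 / 2 + ε))) X) μ𝔤 := by
  haveI : T2Space F := (isLocalField F).toT2Space
  haveI : LocallyCompactSpace F := (isLocalField F).toLocallyCompactSpace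
  haveI : IsTopologicalRing F := inferInstance
  haveI : T2Space (Matrix (Fin 3) (Fin 3) F) := inferInstanceAs (T2Space (Fin 3 → Fin 3 → F))
  haveI : LocallyCompactSpace (Matrix (Fin 3) (Fin 3) F) := Pi.locallyCompactSpace_of_finite
  letI : MeasurableSpace F := borel F
  haveI : BorelSpace F := ⟨rfl⟩
  set 𝔤' : Set (Matrix (Fin 3) (Fin 3) F) := {Y : Matrix (Fin 3) (Fin 3) F | Y.charpoly.discr ≠ 0 ∧ Y.charpoly.roots.card = 3} with h𝔤'
  have h𝔤'm : MeasurableSet 𝔤' := (isOpen_setOf_charpoly_discr_ne_zero_and_card_roots_eq 3).measurableSet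
  have hdiscm : Measurable fun Y : Matrix (Fin 3) (Fin 3) F => Y.charpoly.discr := (F0P3cStCharTSHCDGroupToLie.continuous_discr_charpoly (K := F)).measurable
  have hm : Measurable fun X : Matrix (Fin 3) (Fin 3) F => 𝔤'.indicator (fun Y => ((normAbs F Y.charpoly.discr : ℝ)) ^ (-(1 / 2 + ε))) X :=
    (((measurable_normAbs.comp hdiscm).coe_nnreal_real).pow_const _).indicator h𝔤'm
  refine (locallyIntegrable_iff).2 fun S hS => ⟨hm.aestronglyMeasurable, ?_⟩
  show ∫⁻ X in S, ‖𝔤'.indicator (fun Y => ((normAbs F Y.charpoly.discr : ℝ)) ^ (-(1 / 2 + ε))) X‖ₑ ∂μ𝔤 < ∞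
  have hpt : ∀ X, ‖𝔤'.indicator (fun Y => ((normAbs F Y.charpoly.discr : ℝ)) ^ (-(1 / 2 + ε))) X‖ₑ =
      𝔤'.indicator (fun Y => ((normAbs F Y.charpoly.discr : ℝ≥0∞)) ^ (-(1 / 2 + ε))) X := by
    intro X
    by_cases hX : X ∈ 𝔤'
    · rw [indicator_of_mem hX, indicator_of_mem hX]
      have ht : 0 < (normAbs F X.charpoly.discr : ℝ) := NNReal.coe_pos.2 (pos_iff_ne_zero.2 ((map_ne_zero (normAbs F)).2 hX.1))
      rw [Real.enorm_eq_ofReal (Real.rpow_nonneg ht.le _), ← ENNReal.ofReal_rpow_of_pos ht, ENNReal.ofReal_coe_nnreal]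
    · rw [indicator_of_notMem hX, indicator_of_notMem hX, enorm_zero]
  simp_rw [hpt]
  exact setLIntegral_indicator_split_rpow_neg_lt_top μ𝔤 hS hε

end Main

end Summit.HodgeConjecture.HodgeConjecture.Cruxes.H413.K2E3GL3SplitDiscriminantLocIntegrable

end
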